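import Mathlib
import HarnessLib
import Summits.NavierStokesRegularity.NavierStokesRegularity.Theorems.CompletionRelayChainRelayFrontStepIgnitionSigns
import Summits.NavierStokesRegularity.NavierStokesRegularity.Theorems.CompletionRelayChainRelayFrontStepIgnitionWakeFlux
import Summits.NavierStokesRegularity.NavierStokesRegularity.Theorems.CompletionRelayChainRelayFrontStepIgnitionLinearInt

/-!
# `CompletionRelayChain` — crux `RelayFrontStep` (24850), LINE `window_v2`, stub `stub_ignition` (Phase II):
  FLOORS of the old shells `1, 2` on `[0, T*]` (blueprint §1)

From the `W₃` start (`|x₂(0)|,|u₂(0)| ≤ 5e-10`, `r₁(0) ≥ −1e-8`), the Phase-I envelope on `[0,T*]`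
(`x₂ ≤ 3/250`, `|u₂| ≤ 1e-7`, `u₁ ∈ [−1e-6, 4/25]`, `r₁ ∈ [−1e-5, 3e-5]`, `|r₂| ≤ 2e-9`), the per-mode envelope
`F ≤ relayEnv₂` of old shells `0,1,2`, the tail bound `Σᵢ F i 3 ≤ 6e-20`, the slack bounds `B₀ i 1 ≤ 18e-7`,
`B₀ i 2 ≤ 9e-7` and `κ₁, κ₂ ≤ 1e-8`:
* `energy_le_slack`: `F ≤ ½S² + B₀ + κ₂4^k·M·s` when `F ≤ M` on `[0,s]` ((4.10) upper);
* `x2_floor_phaseI`: `x₂ ≥ −4e-9` on `[0,T*]` (`x₂′ ≥ −32u₂² − 16κ₁√F₀₂`);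
* `r1_floor_phaseI`: `r₁ ≥ −2.2e-8` on `[0,T*]` (`r₁′ ≥ (Λ₁/32)u₁(x₂ − u₂) − 4κ₁√F₂₁`, sign cases on `u₁`);
* `int_u1_sq_phaseI`, `int_abs_u1_phaseI`: `Λ₁∫₀^{T*}u₁² ≤ x₂(T*) − x₂(0) + tiny`, so `∫u₁² ≤ 1.93e-3`,
  `∫|u₁| ≤ 0.0666` (AM–GM with `λ = 29/1000`);
(the next-trigger floor `u₂ ≥ −2.9e-9` is in `…IgnitionFloorsU2`, built on these).

No definitions. HONEST FRAMING: MODEL lattice only (Tao 2016 §4 vocabulary); helper for one registered stub of an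
open crux, no stub credit; nothing here is a statement about the Navier–Stokes equations.
-/

noncomputable section

-- the summit-side namespace repeats a component by design (D-0017)
set_option linter.dupNamespace false

open Set MeasureTheory intervalIntegral Literature.Analysis.FluidPDE Literature.Analysis.FluidPDE.TaoCascade
open Summit.NavierStokesRegularity.NavierStokesRegularity.Theorems
open Summit.NavierStokesRegularity.NavierStokesRegularity.Theorems.RelayFrontStep

namespace Summit.NavierStokesRegularity.NavierStokesRegularity.Cruxes.RelayFrontStep.Window2

variable {τ κ₁ κ₂ : ℝ} {α : Fin 4 → Fin 4 → Fin 4 → ℤ × ℤ × ℤ → ℝ}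
  {S₀ F₀ B₀ : Fin 4 → ℤ → ℝ} {S F : Fin 4 → ℤ → ℝ → ℝ}

/-! ### Numerals -/

/-- The front clock `Λ₁ = 2^{5/2} ∈ [5.6568, 5.6569]`. [this file] -/
theorem clock_one_bounds : 56568 / 10000 ≤ (1 + 1 : ℝ) ^ ((5 : ℝ) * (((1 : ℤ)) : ℝ) / 2) ∧
    (1 + 1 : ℝ) ^ ((5 : ℝ) * (((1 : ℤ)) : ℝ) / 2) ≤ 56569 / 10000 := by
  have hsq := clock_sq (1 : ℤ)
  have h32 : ((1 + 1 : ℝ) ^ ((5 : ℝ) * (((1 : ℤ)) : ℝ) / 2)) ^ 2 = 32 := by rw [hsq]; norm_num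
  have hpos : 0 ≤ (1 + 1 : ℝ) ^ ((5 : ℝ) * (((1 : ℤ)) : ℝ) / 2) := clock_nonneg _
  constructor <;> nlinarith

/-- `aheadE 2 = ½·(5e-10)²`. [this file] -/
theorem aheadE_two : aheadE 2 = (1 / 2) * (5 / 10 ^ 10) ^ 2 := by
  unfold aheadE; norm_num

/-- `relayEnv₂ 2 = 1/2`, `relayEnv₂ 1 = 1`. [this file] -/
theorem relayEnv₂_two : relayEnv₂ 2 = 1 / 2 := by
  unfold relayEnv₂; rw [if_pos (by norm_num)]
  rw [show (-(((2 : ℤ)) : ℝ)) = -((2 : ℕ) : ℝ) by norm_num, Real.rpow_neg (by norm_num), Real.rpow_natCast]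
  norm_num

/-- `relayEnv₂ 1 = 1`. [this file] -/
theorem relayEnv₂_one : relayEnv₂ 1 = 1 := by
  unfold relayEnv₂; rw [if_pos (by norm_num)]
  rw [show (-(((1 : ℤ)) : ℝ)) = -((1 : ℕ) : ℝ) by norm_num, Real.rpow_neg (by norm_num), Real.rpow_natCast]
  norm_num

/-- `e^{0.88202} ≤ 2.4158` (Taylor to order 6). [this file] -/
theorem exp_088202_le : Real.exp (88202 / 100000) ≤ 24158 / 10000 := by
  have h := Real.exp_bound (x := 88202 / 100000) (by rw [abs_le]; constructor <;> norm_num) (n := 6) (by norm_num)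
  rw [abs_le] at h
  have h2 := h.2
  simp only [Finset.sum_range_succ, Finset.sum_range_zero, Nat.factorial] at h2
  norm_num at h2
  linarith

/-! ### (4.10) upper with a crude energy bound -/

/-- **Energy under the slack**: if `F i k ≤ M` on `[0, s]` (`M ≥ 0`, `κ₂ ≥ 0`), then
`F i k s ≤ ½ S i k s² + B₀ i k + κ₂·(1+1)^{2k}·(M·s)`. [cite: Tao2016AveragedNS, §4 Lemma 4.1 (4.10)] -/
theorem energy_le_slack (h : PseudoFlowOn τ 1 α κ₁ κ₂ S₀ F₀ B₀ S F) (hκ : 0 ≤ κ₂) (i : Fin 4) (k : ℤ)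
    {s M : ℝ} (hs : s ∈ Icc 0 τ) (hM : ∀ r ∈ Icc 0 s, F i k r ≤ M) :
    F i k s ≤ (1 / 2) * S i k s ^ 2 + B₀ i k + κ₂ * (1 + 1 : ℝ) ^ ((2 : ℝ) * k) * (M * s) := by
  have h1 := h.defect_upper i k s hs
  have hsub : uIcc 0 s ⊆ Icc 0 τ := by rw [uIcc_of_le hs.1]; exact Icc_subset_Icc_right hs.2
  have hint : IntervalIntegrable (fun u => F i k u) volume 0 s :=
    ((h.contDiffOn_F i k).continuousOn.mono hsub).intervalIntegrable
  have h2 : (∫ u in (0 : ℝ)..s, F i k u) ≤ ∫ u in (0 : ℝ)..s, M :=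
    intervalIntegral.integral_mono_on hs.1 hint (by simp) fun u hu => hM u hu
  rw [intervalIntegral.integral_const, smul_eq_mul, sub_zero, mul_comm] at h2
  have hw : 0 ≤ κ₂ * (1 + 1 : ℝ) ^ ((2 : ℝ) * k) := mul_nonneg hκ (Real.rpow_pos_of_pos (by norm_num) _).le
  have h3 := mul_le_mul_of_nonneg_left h2 hw
  simp only [one_add_one_eq_two] at h1 h3 ⊢
  linarith


/-! ### The carrier floor `x₂ ≥ −4e-9` on `[0, T*]` -/

/-- Start of old shell `2`'s carrier and trigger: `|x₂(0)|, |u₂(0)| ≤ 5e-10` from the far-ahead clause. [this file] -/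
theorem shell_two_start (h : PseudoFlowOn τ 1 α κ₁ κ₂ S₀ F₀ B₀ S F) (hτ : 0 < τ)
    (hahead : ∀ i : Fin 4, i ≠ 3 → F₀ i 2 ≤ aheadE 2) :
    |S 0 2 0| ≤ 5 / 10 ^ 10 ∧ |S 1 2 0| ≤ 5 / 10 ^ 10 := by
  have h0 : (0 : ℝ) ∈ Icc 0 τ := ⟨le_rfl, hτ.le⟩
  have hx := h.defect_lower 0 2 0 h0
  have hu := h.defect_lower 1 2 0 h0
  rw [h.init_F] at hx hu
  have hax := hahead 0 (by decide)
  have hau := hahead 1 (by decide)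
  rw [aheadE_two] at hax hau
  exact ⟨abs_le_of_sq_le_sq (by linarith) (by norm_num), abs_le_of_sq_le_sq (by linarith) (by norm_num)⟩

/-- `√F 0 2 ≤ 9/1000` on `[0, T*]` from the envelope `x₂ ∈ [−1/500, 3/250]`, `F 0 2 ≤ ½`, slack `B₀ ≤ 9e-7`,
`κ₂ ≤ 1e-8`. [this file] -/
theorem sqrt_F02_le (h : PseudoFlowOn τ 1 α κ₁ κ₂ S₀ F₀ B₀ S F) (hκ2 : 0 ≤ κ₂) (hκ2' : κ₂ ≤ 1 / 10 ^ 8)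
    (hTτ : Tstar ≤ τ) (hB2 : ∀ i, B₀ i 2 ≤ 9 / 10 ^ 7)
    (hEnv2 : ∀ s ∈ Icc (0 : ℝ) Tstar, F 0 2 s ≤ relayEnv₂ 2)
    (hx2P : ∀ s ∈ Icc (0 : ℝ) Tstar, -(1 / 500 : ℝ) ≤ S 0 2 s ∧ S 0 2 s ≤ 3 / 250) :
    ∀ s ∈ Icc (0 : ℝ) Tstar, Real.sqrt (F 0 2 s) ≤ 9 / 1000 := by
  intro s hs
  have hsτ : s ∈ Icc 0 τ := ⟨hs.1, hs.2.trans hTτ⟩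
  have h1 := energy_le_slack h hκ2 0 2 hsτ (M := 1 / 2) fun r hr => by
    have := hEnv2 r ⟨hr.1, hr.2.trans hs.2⟩; rwa [relayEnv₂_two] at this
  rw [weight_at_two] at h1
  have hx := hx2P s hs
  have hsq : S 0 2 s ^ 2 ≤ (3 / 250) ^ 2 := by nlinarith [hx.1, hx.2]
  have hsT : s ≤ 147 / 64 := hs.2.trans (by unfold Tstar; norm_num)
  have hk : κ₂ * 16 * (1 / 2 * s) ≤ 1 / 10 ^ 8 * 16 * (1 / 2 * (147 / 64)) := by
    have hs0 : 0 ≤ s := hs.1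
    nlinarith
  have hF : F 0 2 s ≤ (9 / 1000) ^ 2 := by linarith [hB2 0]
  calc Real.sqrt (F 0 2 s) ≤ Real.sqrt ((9 / 1000) ^ 2) := Real.sqrt_le_sqrt hF
    _ = 9 / 1000 := Real.sqrt_sq (by norm_num)

/-- **`x₂ ≥ −4e-9` on `[0, T*]`.** [this file] -/
theorem x2_floor_phaseI (h : PseudoFlowOn τ 1 α κ₁ κ₂ S₀ F₀ B₀ S F) (hrows : RelayRows α) (hτ : 0 < τ)
    (hκ1 : 0 ≤ κ₁) (hκ1' : κ₁ ≤ 1 / 10 ^ 8) (hκ2 : 0 ≤ κ₂) (hκ2' : κ₂ ≤ 1 / 10 ^ 8) (hTτ : Tstar ≤ τ)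
    (hahead : ∀ i : Fin 4, i ≠ 3 → F₀ i 2 ≤ aheadE 2) (hB2 : ∀ i, B₀ i 2 ≤ 9 / 10 ^ 7)
    (hEnv2 : ∀ s ∈ Icc (0 : ℝ) Tstar, F 0 2 s ≤ relayEnv₂ 2)
    (hx2P : ∀ s ∈ Icc (0 : ℝ) Tstar, -(1 / 500 : ℝ) ≤ S 0 2 s ∧ S 0 2 s ≤ 3 / 250)
    (hu2P : ∀ s ∈ Icc (0 : ℝ) Tstar, |S 1 2 s| ≤ 1 / 10 ^ 7) :
    ∀ t ∈ Icc (0 : ℝ) Tstar, -(4 / 10 ^ 9 : ℝ) ≤ S 0 2 t := by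
  intro t ht
  have hT0 : (0 : ℝ) ≤ Tstar := by unfold Tstar; norm_num
  have hG := sqrt_F02_le h hκ2 hκ2' hTτ hB2 hEnv2 hx2P
  have hlin := x2_lower_linear h hrows hτ hκ1 le_rfl hT0 hTτ hu2P hG t ht
  have h0 := (abs_le.mp (shell_two_start h hτ hahead).1).1
  have htT : t ≤ 147 / 64 := ht.2.trans (by unfold Tstar; norm_num)
  have ht0 : 0 ≤ t := ht.1
  have hk : (32 * (1 / 10 ^ 7) ^ 2 + 16 * κ₁ * (9 / 1000)) * t ≤
      (32 * (1 / 10 ^ 7) ^ 2 + 16 * (1 / 10 ^ 8) * (9 / 1000)) * (147 / 64) :=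
    mul_le_mul (by nlinarith) htT ht0 (by positivity)
  nlinarith

/-! ### The next-relay floor `r₁ ≥ −2.2e-8` on `[0, T*]` -/

/-- `√F 2 1 ≤ 14/10000` on `[0, T*]` from `r₁ ∈ [−1e-5, 3e-5]`, `F 2 1 ≤ 1`, slack `B₀ ≤ 18e-7`, `κ₂ ≤ 1e-8`.
[this file] -/
theorem sqrt_F21_le (h : PseudoFlowOn τ 1 α κ₁ κ₂ S₀ F₀ B₀ S F) (hκ2 : 0 ≤ κ₂) (hκ2' : κ₂ ≤ 1 / 10 ^ 8)
    (hTτ : Tstar ≤ τ) (hB1 : ∀ i, B₀ i 1 ≤ 18 / 10 ^ 7)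
    (hEnv1 : ∀ s ∈ Icc (0 : ℝ) Tstar, F 2 1 s ≤ relayEnv₂ 1)
    (hr1P : ∀ s ∈ Icc (0 : ℝ) Tstar, -(1 / 100000 : ℝ) ≤ S 2 1 s ∧ S 2 1 s ≤ 3 / 100000) :
    ∀ s ∈ Icc (0 : ℝ) Tstar, Real.sqrt (F 2 1 s) ≤ 14 / 10000 := by
  intro s hs
  have hsτ : s ∈ Icc 0 τ := ⟨hs.1, hs.2.trans hTτ⟩
  have h1 := energy_le_slack h hκ2 2 1 hsτ (M := 1) fun r hr => by
    have := hEnv1 r ⟨hr.1, hr.2.trans hs.2⟩; rwa [relayEnv₂_one] at this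
  rw [weight_at_one] at h1
  have hx := hr1P s hs
  have hsq : S 2 1 s ^ 2 ≤ (3 / 100000) ^ 2 := by nlinarith [hx.1, hx.2]
  have hsT : s ≤ 147 / 64 := hs.2.trans (by unfold Tstar; norm_num)
  have hk : κ₂ * 4 * (1 * s) ≤ 1 / 10 ^ 8 * 4 * (1 * (147 / 64)) := by
    have hs0 : 0 ≤ s := hs.1
    nlinarith
  have hF : F 2 1 s ≤ (14 / 10000) ^ 2 := by linarith [hB1 2]
  calc Real.sqrt (F 2 1 s) ≤ Real.sqrt ((14 / 10000) ^ 2) := Real.sqrt_le_sqrt hF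
    _ = 14 / 10000 := Real.sqrt_sq (by norm_num)

/-- **`r₁ ≥ −2.2e-8` on `[0, T*]`.** [this file] -/
theorem r1_floor_phaseI (h : PseudoFlowOn τ 1 α κ₁ κ₂ S₀ F₀ B₀ S F) (hrows : RelayRows α) (hτ : 0 < τ)
    (hκ1 : 0 ≤ κ₁) (hκ1' : κ₁ ≤ 1 / 10 ^ 8) (hκ2 : 0 ≤ κ₂) (hκ2' : κ₂ ≤ 1 / 10 ^ 8) (hTτ : Tstar ≤ τ)
    (hr10 : -(1 / 10 ^ 8 : ℝ) ≤ S₀ 2 1) (hB1 : ∀ i, B₀ i 1 ≤ 18 / 10 ^ 7)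
    (hEnv1 : ∀ s ∈ Icc (0 : ℝ) Tstar, F 2 1 s ≤ relayEnv₂ 1)
    (hx2m : ∀ s ∈ Icc (0 : ℝ) Tstar, -(4 / 10 ^ 9 : ℝ) ≤ S 0 2 s)
    (hx2P : ∀ s ∈ Icc (0 : ℝ) Tstar, S 0 2 s ≤ 3 / 250)
    (hu2P : ∀ s ∈ Icc (0 : ℝ) Tstar, |S 1 2 s| ≤ 1 / 10 ^ 7)
    (hu1P : ∀ s ∈ Icc (0 : ℝ) Tstar, -(1 / 1000000 : ℝ) ≤ S 1 1 s ∧ S 1 1 s ≤ 4 / 25)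
    (hr1P : ∀ s ∈ Icc (0 : ℝ) Tstar, -(1 / 100000 : ℝ) ≤ S 2 1 s ∧ S 2 1 s ≤ 3 / 100000) :
    ∀ t ∈ Icc (0 : ℝ) Tstar, -(22 / 10 ^ 9 : ℝ) ≤ S 2 1 t := by
  have hT0 : (0 : ℝ) ≤ Tstar := by unfold Tstar; norm_num
  have hG := sqrt_F21_le h hκ2 hκ2' hTτ hB1 hEnv1 hr1P
  obtain ⟨hΛlo, hΛhi⟩ := clock_one_bounds
  -- the derivative floor
  have hC : ∀ s ∈ Icc (0 : ℝ) Tstar,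
      -((1 / 32) * (56569 / 10000) * (29 / 10 ^ 9) + κ₁ * 4 * (14 / 10000)) ≤ derivWithin (S 2 1) (Icc 0 τ) s := by
    intro s hs
    have hsτ : s ∈ Icc 0 τ := ⟨hs.1, hs.2.trans hTτ⟩
    have hd := r1_deriv_lower h hrows hsτ
    have hu := hu1P s hs; have hx := hx2P s hs; have hxm := hx2m s hs
    have hu2 := abs_le.mp (hu2P s hs)
    -- u₁ (x₂ − u₂) ≥ −2.9e-8 by the sign split
    have hprod : -(29 / 10 ^ 9 : ℝ) ≤ S 0 2 s * S 1 1 s - S 1 1 s * S 1 2 s := by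
      have e : S 0 2 s * S 1 1 s - S 1 1 s * S 1 2 s = S 1 1 s * (S 0 2 s - S 1 2 s) := by ring
      rw [e]
      have hd1 : -(104 / 10 ^ 9 : ℝ) ≤ S 0 2 s - S 1 2 s := by linarith
      have hd2 : S 0 2 s - S 1 2 s ≤ 3 / 250 + 1 / 10 ^ 7 := by linarith
      nlinarith [mul_nonneg (by linarith : 0 ≤ S 1 1 s + 1 / 1000000) (by linarith : 0 ≤ S 0 2 s - S 1 2 s + 104 / 10 ^ 9),
        mul_nonneg (by linarith : 0 ≤ 4 / 25 - S 1 1 s) (by linarith : 0 ≤ S 0 2 s - S 1 2 s + 104 / 10 ^ 9)]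
    have h1 : (1 / 32) * ((1 + 1 : ℝ) ^ ((5 : ℝ) * (((1 : ℤ)) : ℝ) / 2) * (S 0 2 s * S 1 1 s - S 1 1 s * S 1 2 s)) ≥
        -((1 / 32) * (56569 / 10000) * (29 / 10 ^ 9)) := by
      have hΛ0 : 0 ≤ (1 + 1 : ℝ) ^ ((5 : ℝ) * (((1 : ℤ)) : ℝ) / 2) := clock_nonneg _
      nlinarith [mul_le_mul_of_nonneg_left hprod hΛ0]
    have h2 : κ₁ * 4 * Real.sqrt (F 2 1 s) ≤ κ₁ * 4 * (14 / 10000) :=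
      mul_le_mul_of_nonneg_left (hG s hs) (by positivity)
    linarith
  intro t ht
  have hlin := lower_linear_of_derivWithin_ge hτ (h.contDiffOn_S 2 1) le_rfl hT0 hTτ hC t ht
  rw [h.init_S 2 1] at hlin
  have htT : t ≤ 147 / 64 := ht.2.trans (by unfold Tstar; norm_num)
  have ht0 : 0 ≤ t := ht.1
  have hk : ((1 / 32) * (56569 / 10000) * (29 / 10 ^ 9) + κ₁ * 4 * (14 / 10000)) * (t - 0) ≤
      ((1 / 32) * (56569 / 10000) * (29 / 10 ^ 9) + 1 / 10 ^ 8 * 4 * (14 / 10000)) * (147 / 64) := by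
    rw [sub_zero]; exact mul_le_mul (by nlinarith) htT ht0 (by positivity)
  nlinarith


/-! ### `∫₀^{T*} u₁²` and `∫₀^{T*} |u₁|` from the carrier equation of old shell `2` -/

/-- Old shell 2's carrier with the source kept: `x₂′ ≥ 5.6568·u₁² − 32u₂² − 16κ₁√F 0 2`. [this file] -/
theorem x2_deriv_lower' (h : PseudoFlowOn τ 1 α κ₁ κ₂ S₀ F₀ B₀ S F) (hrows : RelayRows α)
    {s : ℝ} (hs : s ∈ Icc 0 τ) :
    56568 / 10000 * S 1 1 s ^ 2 - 32 * S 1 2 s ^ 2 - 16 * κ₁ * Real.sqrt (F 0 2 s) ≤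
      derivWithin (S 0 2) (Icc 0 τ) s := by
  have hm := h.motion 0 2 s hs
  rw [hrows.1 S 2 s, clock_at_two, weight_at_two] at hm
  have hlow := (abs_le.mp hm).1
  have e : (1 + 1 : ℝ) ^ ((5 : ℝ) * ((((2 : ℤ)) : ℝ) - 1) / 2) = (1 + 1 : ℝ) ^ ((5 : ℝ) * (((1 : ℤ)) : ℝ) / 2) := by
    norm_num
  rw [e, show (2 - 1 : ℤ) = 1 by norm_num] at hlow
  have hΛ := clock_one_bounds.1
  have h1 : 56568 / 10000 * S 1 1 s ^ 2 ≤ (1 + 1 : ℝ) ^ ((5 : ℝ) * (((1 : ℤ)) : ℝ) / 2) * (S 1 1 s * S 1 1 s) := by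
    rw [← pow_two]; exact mul_le_mul_of_nonneg_right hΛ (sq_nonneg _)
  nlinarith [sq_nonneg (S 1 2 s)]

/-- **`∫₀^{T*} u₁² ≤ 1.93e-3`**: `5.6568·∫u₁² ≤ x₂(T*) − x₂(0) + (32·1e-14 + 16κ₁·0.009)·T*` with
`x₂(T*) ≤ 0.01091` (END-BOX) and `x₂(0) ≥ −5e-10`. [this file] -/
theorem int_u1_sq_phaseI (h : PseudoFlowOn τ 1 α κ₁ κ₂ S₀ F₀ B₀ S F) (hrows : RelayRows α) (hτ : 0 < τ)
    (hκ1 : 0 ≤ κ₁) (hκ1' : κ₁ ≤ 1 / 10 ^ 8) (hκ2 : 0 ≤ κ₂) (hκ2' : κ₂ ≤ 1 / 10 ^ 8) (hTτ : Tstar ≤ τ)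
    (hahead : ∀ i : Fin 4, i ≠ 3 → F₀ i 2 ≤ aheadE 2) (hB2 : ∀ i, B₀ i 2 ≤ 9 / 10 ^ 7)
    (hEnv2 : ∀ s ∈ Icc (0 : ℝ) Tstar, F 0 2 s ≤ relayEnv₂ 2)
    (hx2P : ∀ s ∈ Icc (0 : ℝ) Tstar, -(1 / 500 : ℝ) ≤ S 0 2 s ∧ S 0 2 s ≤ 3 / 250)
    (hu2P : ∀ s ∈ Icc (0 : ℝ) Tstar, |S 1 2 s| ≤ 1 / 10 ^ 7) (hx2T : S 0 2 Tstar ≤ 1091 / 100000) :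
    (∫ s in (0 : ℝ)..Tstar, S 1 1 s ^ 2) ≤ 193 / 100000 := by
  have hT0 : (0 : ℝ) ≤ Tstar := by unfold Tstar; norm_num
  have hG := sqrt_F02_le h hκ2 hκ2' hTτ hB2 hEnv2 hx2P
  have hsub : Icc 0 Tstar ⊆ Icc 0 τ := Icc_subset_Icc_right hTτ
  set C : ℝ := 32 * (1 / 10 ^ 7) ^ 2 + 16 * κ₁ * (9 / 1000) with hC
  have hcont : ContinuousOn (fun s => 56568 / 10000 * S 1 1 s ^ 2 - C) (Icc 0 Tstar) :=
    (continuousOn_const.mul (((h.contDiffOn_S 1 1).continuousOn.mono hsub).pow 2)).sub continuousOn_const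
  have hint := integral_le_increment_of_le_derivWithin hτ (h.contDiffOn_S 0 2) hcont le_rfl hT0 hTτ
    (fun s hs => by
      have hsτ : s ∈ Icc 0 τ := hsub hs
      have h1 := x2_deriv_lower' h hrows hsτ
      have h2 : S 1 2 s ^ 2 ≤ (1 / 10 ^ 7) ^ 2 := by
        rw [← sq_abs]; exact pow_le_pow_left₀ (abs_nonneg _) (hu2P s hs) 2
      have h3 := mul_le_mul_of_nonneg_left (hG s hs) (by positivity : (0 : ℝ) ≤ 16 * κ₁)
      rw [hC]; nlinarith)
  have hi1 : IntervalIntegrable (fun s => 56568 / 10000 * S 1 1 s ^ 2) volume 0 Tstar :=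
    ((continuousOn_const.mul (((h.contDiffOn_S 1 1).continuousOn.mono hsub).pow 2)).mono
      (by rw [uIcc_of_le hT0])).intervalIntegrable
  rw [intervalIntegral.integral_sub hi1 (by simp), intervalIntegral.integral_const, smul_eq_mul,
    intervalIntegral.integral_const_mul] at hint
  have h0 := (abs_le.mp (shell_two_start h hτ hahead).1).1
  have hCle : C ≤ 32 * (1 / 10 ^ 7) ^ 2 + 16 * (1 / 10 ^ 8) * (9 / 1000) := by rw [hC]; nlinarith
  have hCT : (Tstar - 0) * C ≤ 147 / 64 * (32 * (1 / 10 ^ 7) ^ 2 + 16 * (1 / 10 ^ 8) * (9 / 1000)) := by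
    rw [sub_zero]; unfold Tstar; exact mul_le_mul_of_nonneg_left hCle (by norm_num)
  nlinarith

/-- **`∫₀^{T*} |u₁| ≤ 0.0667`** (AM–GM with `λ = 29/1000` and `∫u₁² ≤ 1.93e-3`). [this file] -/
theorem int_abs_u1_phaseI (h : PseudoFlowOn τ 1 α κ₁ κ₂ S₀ F₀ B₀ S F) (hTτ : Tstar ≤ τ)
    (hsq : (∫ s in (0 : ℝ)..Tstar, S 1 1 s ^ 2) ≤ 193 / 100000) :
    (∫ s in (0 : ℝ)..Tstar, |S 1 1 s|) ≤ 667 / 10000 := by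
  have hT0 : (0 : ℝ) ≤ Tstar := by unfold Tstar; norm_num
  have hsub : Icc 0 Tstar ⊆ Icc 0 τ := Icc_subset_Icc_right hTτ
  have hc : ContinuousOn (fun s => S 1 1 s) (uIcc 0 Tstar) := by
    rw [uIcc_of_le hT0]; exact (h.contDiffOn_S 1 1).continuousOn.mono hsub
  have hi1 : IntervalIntegrable (fun s => |S 1 1 s|) volume 0 Tstar := hc.abs.intervalIntegrable
  have hi2 : IntervalIntegrable (fun s => 29 / 2000 + 1000 / 58 * S 1 1 s ^ 2) volume 0 Tstar :=
    (continuousOn_const.add (continuousOn_const.mul (hc.pow 2))).intervalIntegrable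
  have hmono := intervalIntegral.integral_mono_on hT0 hi1 hi2 fun s _ => by
    show |S 1 1 s| ≤ 29 / 2000 + 1000 / 58 * S 1 1 s ^ 2
    nlinarith [sq_nonneg (|S 1 1 s| - 29 / 1000), sq_abs (S 1 1 s), abs_nonneg (S 1 1 s)]
  have hi3 : IntervalIntegrable (fun s => 1000 / 58 * S 1 1 s ^ 2) volume 0 Tstar := by
    exact (continuousOn_const.mul (hc.pow 2)).intervalIntegrable
  have hi4 : IntervalIntegrable (fun _ : ℝ => (29 / 2000 : ℝ)) volume 0 Tstar := by simp
  rw [intervalIntegral.integral_add hi4 hi3, intervalIntegral.integral_const, smul_eq_mul,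
    intervalIntegral.integral_const_mul] at hmono
  unfold Tstar at hmono hsq ⊢
  linarith


end Summit.NavierStokesRegularity.NavierStokesRegularity.Cruxes.RelayFrontStep.Window2
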